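import Mathlib
import Literature.RingTheory.KrullDimension.FibreDimension
import Literature.RingTheory.KrullDimension.GenericAvoidance
import Literature.RingTheory.KrullDimension.ZariskiClosureInfinite

/-!
# Crux `DetQP.DetqpSuperquadratic` (stmt-ValiantsHypothesis-0318), line `sectional-class-ladder` —
# helper for stub `stub_polarGenericFinite`: generic finiteness of the fibres of an incidence variety

The commutative algebra behind "the polar set of a form is finite for generic pencil/chart data"
(`Theorems/DetQPDetqpSuperquadraticStubPolarGenericFinite.lean`), in the affine form in which it is
used there:

* `zeroLocus_finite_of_ringKrullDim_le_zero` — the zero set of an ideal `I ⊆ k[X_ι]` with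
  `dim k[X_ι] ⧸ I ≤ 0` is finite (an infinite set of points has a positive-dimensional component,
  `Literature.RingTheory.KrullDimension.exists_mem_minimalPrimes_inter_infinite`);
* `ringKrullDim_quotient_le_of_forall_isPrime` — `dim R ⧸ J ≤ n` as soon as `dim R ⧸ Q ≤ n` for
  every prime `Q ⊇ J`;
* **`exists_ne_zero_finite_fibre`** — GENERIC FINITENESS: for an algebraically closed field `k`,
  finite sets `P` (parameters) and `Y` (unknowns) and an ideal `J ⊆ k[P ⊕ Y]` of an incidence
  variety `E = V(J) ⊆ k^P × k^Y` with `dim k[P ⊕ Y] ⧸ J ≤ #P`, there is a non-zero polynomial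
  `Φ ∈ k[P]` such that the fibre `{y | (u, y) ∈ E}` is finite for every `u` with `Φ(u) ≠ 0`.
  Proof: for each of the finitely many minimal primes `Q` of `J`, either `k[P] → k[P ⊕ Y] ⧸ Q` is
  not injective (a non-zero element of the kernel kills the whole component), or it is, and then
  `dim (k[P ⊕ Y] ⧸ Q) = #P = dim k[P]`, so by the theorem on the dimension of the generic fibres
  (`Literature.RingTheory.KrullDimension.exists_ringKrullDim_quotient_eq_of_mem_minimalPrimes`,
  Springer LAG 5.1.6 (ii)) the fibres over a basic open set `D(f)` are zero-dimensional, hence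
  finite;
* tools for bounding `dim = trdeg` of an affine domain by the size of an algebraically spanning
  set of generators: `isAlgebraic_of_mul_eq` (solutions of `u z = r`, `u ≠ 0`, are algebraic),
  `exists_isAlgebraic_adjoin_image_compl` (a dependent family has a member algebraic over the
  others — the algebraic matroid), `isAlgebraic_adjoin_of_forall_generator`,
  `ringKrullDim_le_card_of_isAlgebraic_adjoin`.
-/

noncomputable section

-- `Summit.ValiantsHypothesis.ValiantsHypothesis.…` is the tree's mandated single-conjunct layout (Sub = Summit).
set_option linter.dupNamespace false

namespace Summit.ValiantsHypothesis.ValiantsHypothesis.Theorems.DetQPDetqpSuperquadratic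

open MvPolynomial
open Literature.RingTheory.KrullDimension

/-! ### Zero-dimensional ideals have finite zero sets -/

/-- The zero set (over any extension field `K`) of an ideal `I ⊆ k[X_ι]` (`ι` finite) with
`dim k[X_ι] ⧸ I ≤ 0` is finite: otherwise some component of the Zariski closure of the zero set is
positive-dimensional, and its prime contains `I`. [folklore] -/
theorem zeroLocus_finite_of_ringKrullDim_le_zero {k K : Type*} [Field k] [Field K] [Algebra k K]
    {ι : Type*} [Finite ι] (I : Ideal (MvPolynomial ι k))
    (hI : ringKrullDim (MvPolynomial ι k ⧸ I) ≤ 0) : (zeroLocus K I).Finite := by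
  by_contra hinf
  obtain ⟨𝔭, h𝔭, -, -, -, hdim⟩ := exists_mem_minimalPrimes_inter_infinite (k := k) (K := K) hinf
  have hle : I ≤ 𝔭 := (le_vanishingIdeal_zeroLocus I).trans h𝔭.1.2
  have h1 : ringKrullDim (MvPolynomial ι k ⧸ 𝔭) ≤ ringKrullDim (MvPolynomial ι k ⧸ I) :=
    ringKrullDim_le_of_surjective (Ideal.Quotient.factor hle) (Ideal.Quotient.factor_surjective hle)
  have h2 : (1 : WithBot ℕ∞) ≤ 0 := hdim.trans (h1.trans hI)
  exact absurd h2 (by decide)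

/-! ### Dimension of a quotient from its prime quotients -/

/-- `dim R ⧸ J ≤ n` if `dim R ⧸ Q ≤ n` for every prime `Q ⊇ J` (a chain of primes above `J` is a
chain above its bottom prime). [folklore] -/
theorem ringKrullDim_quotient_le_of_forall_isPrime {R : Type*} [CommRing R] (J : Ideal R)
    (n : WithBot ℕ∞) (h : ∀ Q : Ideal R, Q.IsPrime → J ≤ Q → ringKrullDim (R ⧸ Q) ≤ n) :
    ringKrullDim (R ⧸ J) ≤ n := by
  refine (ringKrullDim_quotient_le_iSup J
    (fun Q : {Q : Ideal R // Q.IsPrime ∧ J ≤ Q} => (Q : Ideal R)) fun Q hQ hJQ =>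
      ⟨⟨Q, hQ, hJQ⟩, le_rfl⟩).trans ?_
  exact iSup_le fun Q => h Q.1 Q.2.1 Q.2.2

/-! ### Generic finiteness of the fibres of an incidence variety -/

section GenericFiniteness

variable {k : Type*} [Field k] [IsAlgClosed k] {P Y : Type*} [Finite P] [Finite Y]

omit [IsAlgClosed k] [Finite P] [Finite Y] in
/-- Evaluating a polynomial in the parameters at a point `(u, y)` of `k^P × k^Y`. [folklore] -/
theorem aeval_sumElim_rename_inl (u : P → k) (y : Y → k) (p : MvPolynomial P k) :
    aeval (Sum.elim u y) (rename Sum.inl p) = eval u p := by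
  rw [aeval_rename, Sum.elim_comp_inl]
  rfl

/-- **Generic finiteness, one irreducible component.** For a prime `Q ⊆ k[P ⊕ Y]` with
`dim k[P ⊕ Y] ⧸ Q ≤ #P` there is `Φ ≠ 0` in `k[P]` such that for every `u ∈ k^P` with `Φ(u) ≠ 0`
the fibre `{y | (u, y) ∈ V(Q)}` is finite. [cite: SpringerLAG1998, Thm 5.1.6 (ii)] -/
theorem exists_ne_zero_finite_fibre_of_isPrime (Q : Ideal (MvPolynomial (P ⊕ Y) k)) [Q.IsPrime]
    (hQ : ringKrullDim (MvPolynomial (P ⊕ Y) k ⧸ Q) ≤ Nat.card P) :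
    ∃ Φ : MvPolynomial P k, Φ ≠ 0 ∧ ∀ u : P → k, eval u Φ ≠ 0 →
      {y : Y → k | Sum.elim u y ∈ zeroLocus k Q}.Finite := by
  classical
  haveI : IsNoetherianRing (MvPolynomial (P ⊕ Y) k) := MvPolynomial.isNoetherianRing
  let ιA : MvPolynomial P k →ₐ[k] MvPolynomial (P ⊕ Y) k := rename Sum.inl
  haveI : IsDomain (MvPolynomial (P ⊕ Y) k ⧸ Q) := Ideal.Quotient.isDomain Q
  letI : Algebra (MvPolynomial P k) (MvPolynomial (P ⊕ Y) k ⧸ Q) :=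
    ((Ideal.Quotient.mk Q).comp ιA.toRingHom).toAlgebra
  have halg : ∀ p : MvPolynomial P k, algebraMap (MvPolynomial P k) (MvPolynomial (P ⊕ Y) k ⧸ Q) p
      = Ideal.Quotient.mk Q (ιA p) := fun _ => rfl
  haveI : IsScalarTower k (MvPolynomial P k) (MvPolynomial (P ⊕ Y) k ⧸ Q) :=
    IsScalarTower.of_algebraMap_eq fun c => by
      rw [halg, MvPolynomial.algebraMap_eq, rename_C]
      rfl
  haveI : Algebra.FiniteType k (MvPolynomial (P ⊕ Y) k ⧸ Q) :=
    Algebra.FiniteType.of_surjective (Ideal.Quotient.mkₐ k Q) Ideal.Quotient.mk_surjective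
  by_cases hker : Function.Injective (algebraMap (MvPolynomial P k) (MvPolynomial (P ⊕ Y) k ⧸ Q))
  · haveI : FaithfulSMul (MvPolynomial P k) (MvPolynomial (P ⊕ Y) k ⧸ Q) :=
      (faithfulSMul_iff_algebraMap_injective _ _).2 hker
    obtain ⟨f, e, r, hf0, hdimA, hdimB, hfib⟩ :=
      exists_ringKrullDim_quotient_eq_of_mem_minimalPrimes (A := MvPolynomial P k)
        (B := MvPolynomial (P ⊕ Y) k ⧸ Q) k
    have hA : ringKrullDim (MvPolynomial P k) = Nat.card P := by
      rw [MvPolynomial.ringKrullDim_of_isNoetherianRing, ringKrullDim_eq_zero_of_field, zero_add]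
    have he : e = Nat.card P := by
      rw [hA] at hdimA
      exact_mod_cast hdimA.symm
    have hr : r = 0 := by
      rw [hdimB, he] at hQ
      have : Nat.card P + r ≤ Nat.card P := by exact_mod_cast hQ
      omega
    refine ⟨f, hf0, fun u hu => ?_⟩
    -- the maximal ideal of the point `u`
    set m : Ideal (MvPolynomial P k) := RingHom.ker (eval u : MvPolynomial P k →+* k) with hm
    haveI hmmax : m.IsMaximal :=
      RingHom.ker_isMaximal_of_surjective _ fun c => ⟨C c, eval_C c⟩
    have hfm : f ∉ m := by rwa [hm, RingHom.mem_ker]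
    -- the fibre ring `k[P ⊕ Y] ⧸ (Q + m)` is zero-dimensional
    have hdim0 : ringKrullDim (MvPolynomial (P ⊕ Y) k ⧸ (Q ⊔ m.map ιA.toRingHom)) ≤ 0 := by
      have hdimeq : ringKrullDim ((MvPolynomial (P ⊕ Y) k ⧸ Q) ⧸
          (m.map ιA.toRingHom).map (Ideal.Quotient.mk Q)) =
            ringKrullDim (MvPolynomial (P ⊕ Y) k ⧸ (Q ⊔ m.map ιA.toRingHom)) :=
        ringKrullDim_eq_of_ringEquiv (DoubleQuot.quotQuotEquivQuotSup Q (m.map ιA.toRingHom))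
      rw [← hdimeq, Ideal.map_map]
      change ringKrullDim ((MvPolynomial (P ⊕ Y) k ⧸ Q) ⧸
        m.map (algebraMap (MvPolynomial P k) (MvPolynomial (P ⊕ Y) k ⧸ Q))) ≤ 0
      refine (ringKrullDim_quotient_le_iSup
        (m.map (algebraMap (MvPolynomial P k) (MvPolynomial (P ⊕ Y) k ⧸ Q)))
        (fun p : (m.map (algebraMap (MvPolynomial P k) (MvPolynomial (P ⊕ Y) k ⧸ Q))).minimalPrimes
          => (p : Ideal (MvPolynomial (P ⊕ Y) k ⧸ Q))) fun P' hP' hle => ?_).trans ?_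
      · haveI := hP'
        obtain ⟨p, hp, hple⟩ := Ideal.exists_minimalPrimes_le hle
        exact ⟨⟨p, hp⟩, hple⟩
      · exact iSup_le fun p => by rw [hfib m hmmax hfm p.1 p.2, hr]; rfl
    have hfinZ := zeroLocus_finite_of_ringKrullDim_le_zero (K := k) _ hdim0
    -- `y ↦ (u, y)` maps the fibre injectively into this finite zero set
    have hsub : {y : Y → k | Sum.elim u y ∈ zeroLocus k Q} ⊆
        (fun y : Y → k => Sum.elim u y) ⁻¹' zeroLocus k (Q ⊔ m.map ιA.toRingHom) := by
      intro y hy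
      rw [Set.mem_preimage, mem_zeroLocus_iff]
      intro p hp
      obtain ⟨q, hq, j, hj, rfl⟩ := Submodule.mem_sup.1 hp
      rw [map_add, (mem_zeroLocus_iff.1 hy) q hq, zero_add]
      have hjle : m.map ιA.toRingHom ≤ vanishingIdeal k {Sum.elim u y} := by
        rw [Ideal.map_le_iff_le_comap]
        intro g hg
        rw [Ideal.mem_comap, mem_vanishingIdeal_singleton_iff]
        change aeval (Sum.elim u y) (rename Sum.inl g) = 0
        rw [aeval_sumElim_rename_inl]
        exact hg
      exact (mem_vanishingIdeal_singleton_iff _ _).1 (hjle hj)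
    refine Set.Finite.subset (Set.Finite.preimage (fun y₁ _ y₂ _ h => ?_) hfinZ) hsub
    have := congrArg (fun v => v ∘ Sum.inr) h
    simpa using this
  · obtain ⟨Φ, hΦ0, hΦ⟩ : ∃ Φ : MvPolynomial P k, Φ ≠ 0 ∧
        algebraMap (MvPolynomial P k) (MvPolynomial (P ⊕ Y) k ⧸ Q) Φ = 0 := by
      rw [injective_iff_map_eq_zero] at hker
      push Not at hker
      obtain ⟨a, ha, ha0⟩ := hker
      exact ⟨a, ha0, ha⟩
    refine ⟨Φ, hΦ0, fun u hu => Set.Finite.subset (Set.finite_empty) fun y hy => ?_⟩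
    exfalso
    apply hu
    have hmem : ιA Φ ∈ Q := by
      rw [← Ideal.Quotient.eq_zero_iff_mem]
      exact hΦ
    rw [← aeval_sumElim_rename_inl u y Φ]
    exact (mem_zeroLocus_iff.1 hy) _ hmem

end GenericFiniteness

/-- **Generic finiteness of the fibres of an incidence variety.** Let `k` be algebraically closed,
`P` (parameters) and `Y` (unknowns) finite, and `J ⊆ k[P ⊕ Y]` an ideal with
`dim k[P ⊕ Y] ⧸ J ≤ #P` (every component of the incidence variety `V(J) ⊆ k^P × k^Y` has dimension
at most that of the parameter space). Then there is a non-zero `Φ ∈ k[P]` such that for every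
`u ∈ k^P` with `Φ(u) ≠ 0` the fibre `{y ∈ k^Y | (u, y) ∈ V(J)}` is finite.
[cite: SpringerLAG1998, Thm 5.1.6 (ii)] -/
theorem exists_ne_zero_finite_fibre {k : Type*} [Field k] [IsAlgClosed k] {P Y : Type*}
    [Finite P] [Finite Y] (J : Ideal (MvPolynomial (P ⊕ Y) k))
    (hJ : ringKrullDim (MvPolynomial (P ⊕ Y) k ⧸ J) ≤ Nat.card P) :
    ∃ Φ : MvPolynomial P k, Φ ≠ 0 ∧ ∀ u : P → k, eval u Φ ≠ 0 →
      {y : Y → k | Sum.elim u y ∈ zeroLocus k J}.Finite := by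
  classical
  haveI : IsNoetherianRing (MvPolynomial (P ⊕ Y) k) := MvPolynomial.isNoetherianRing
  have hfin := Ideal.finite_minimalPrimes_of_isNoetherianRing (MvPolynomial (P ⊕ Y) k) J
  have key : ∀ Q ∈ J.minimalPrimes, ∃ Φ : MvPolynomial P k, Φ ≠ 0 ∧ ∀ u : P → k, eval u Φ ≠ 0 →
      {y : Y → k | Sum.elim u y ∈ zeroLocus k Q}.Finite := fun Q hQ => by
    haveI : Q.IsPrime := hQ.1.1
    refine exists_ne_zero_finite_fibre_of_isPrime Q ((ringKrullDim_le_of_surjective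
      (Ideal.Quotient.factor hQ.1.2) (Ideal.Quotient.factor_surjective hQ.1.2)).trans hJ)
  choose! Φ hΦ0 hΦ using key
  refine ⟨∏ Q ∈ hfin.toFinset, Φ Q, Finset.prod_ne_zero_iff.2 fun Q hQ => hΦ0 Q (hfin.mem_toFinset.1 hQ),
    fun u hu => ?_⟩
  rw [map_prod, Finset.prod_ne_zero_iff] at hu
  have hcov : {y : Y → k | Sum.elim u y ∈ zeroLocus k J} ⊆
      ⋃ Q ∈ hfin.toFinset, {y : Y → k | Sum.elim u y ∈ zeroLocus k Q} := by
    intro y hy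
    have hJle : J ≤ vanishingIdeal k {Sum.elim u y} := fun p hp =>
      (mem_vanishingIdeal_singleton_iff _ _).2 ((mem_zeroLocus_iff.1 hy) p hp)
    obtain ⟨Q, hQ, hQle⟩ := Ideal.exists_minimalPrimes_le hJle
    refine Set.mem_iUnion₂.2 ⟨Q, hfin.mem_toFinset.2 hQ, ?_⟩
    exact mem_zeroLocus_iff.2 fun p hp => (mem_vanishingIdeal_singleton_iff _ _).1 (hQle hp)
  exact Set.Finite.subset (Set.Finite.biUnion (Finset.finite_toSet _) fun Q hQ =>
    hΦ Q (hfin.mem_toFinset.1 hQ) u (hu Q hQ)) hcov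

/-! ### Algebraic elements over generated subalgebras -/

section Algebraic

variable {K B : Type*} [Field K] [CommRing B] [IsDomain B] [Algebra K B]

omit [IsDomain B] in
/-- A solution `z` of a linear equation `u z = r` with `u ≠ 0` and `u, r` in a subalgebra `C` is
algebraic over `C`. [folklore] -/
theorem isAlgebraic_of_mul_eq (C : Subalgebra K B) {u r z : B} (hu : u ∈ C) (hr : r ∈ C)
    (hu0 : u ≠ 0) (h : u * z = r) : IsAlgebraic C z := by
  have ha : (⟨u, hu⟩ : C) ≠ 0 := fun h0 => hu0 (congrArg Subtype.val h0)
  refine ⟨Polynomial.C (⟨u, hu⟩ : C) * Polynomial.X + Polynomial.C (-⟨r, hr⟩ : C), ?_, ?_⟩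
  · intro h0
    have hdeg := Polynomial.degree_linear (b := (-⟨r, hr⟩ : C)) ha
    rw [h0, Polynomial.degree_zero] at hdeg
    exact absurd hdeg (by decide)
  · simp only [map_add, map_mul, Polynomial.aeval_C, Polynomial.aeval_X, map_neg]
    change u * z + -r = 0
    rw [h, add_neg_cancel]

/-- If every member of a generating family `ξ` of the `K`-algebra `B` is algebraic over the
subalgebra `K[s]`, then `B` is algebraic over `K[s]` (the algebraic elements form a subalgebra).
[folklore] -/
theorem isAlgebraic_adjoin_of_forall_generator {ι : Type*} (ξ : ι → B)
    (hgen : Algebra.adjoin K (Set.range ξ) = ⊤) (s : Set B)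
    (h : ∀ v, IsAlgebraic (Algebra.adjoin K s) (ξ v)) :
    Algebra.IsAlgebraic (Algebra.adjoin K s) B := by
  set C : Subalgebra K B := Algebra.adjoin K s
  let D : Subalgebra K B := (Subalgebra.algebraicClosure C B).restrictScalars K
  have hD : (⊤ : Subalgebra K B) ≤ D := by
    rw [← hgen, Algebra.adjoin_le_iff]
    rintro _ ⟨v, rfl⟩
    exact h v
  exact ⟨fun b => hD (Algebra.mem_top (x := b))⟩

/-- An element algebraic over `K[s]` is algebraic over `K[t]` for `s ⊆ t`. [folklore] -/
theorem isAlgebraic_adjoin_mono {s t : Set B} (hst : s ⊆ t) {z : B}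
    (hz : IsAlgebraic (Algebra.adjoin K s) z) : IsAlgebraic (Algebra.adjoin K t) z :=
  hz.adjoin_of_forall_isAlgebraic fun _ hx => absurd (hst hx.1) hx.2

/-- In an algebraically DEPENDENT family some member is algebraic over the subalgebra generated by
the others (a dependent set of the algebraic matroid contains an element in the closure of the
rest). [folklore] -/
theorem exists_isAlgebraic_adjoin_image_compl {ι : Type*} (x : ι → B)
    (hx : ¬ AlgebraicIndependent K x) :
    ∃ i, IsAlgebraic (Algebra.adjoin K (x '' {i}ᶜ)) (x i) := by
  classical
  haveI : FaithfulSMul K B :=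
    (faithfulSMul_iff_algebraMap_injective K B).2 (algebraMap K B).injective
  by_cases hinj : Function.Injective x
  · have hdep : ¬ (AlgebraicIndependent.matroid K B).Indep (Set.range x) := by
      rw [AlgebraicIndependent.matroid_indep_iff]
      exact fun h => hx ((algebraicIndependent_subtype_range hinj).1 h)
    rw [Matroid.indep_iff_forall_notMem_closure_sdiff
      (by rw [AlgebraicIndependent.matroid_e]; exact Set.subset_univ _)] at hdep
    push Not at hdep
    obtain ⟨_, ⟨i, rfl⟩, hi⟩ := hdep
    rw [AlgebraicIndependent.matroid_closure_eq, SetLike.mem_coe,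
      Subalgebra.mem_algebraicClosure] at hi
    refine ⟨i, hi.adjoin_of_forall_isAlgebraic fun z hz => ?_⟩
    exfalso
    obtain ⟨⟨⟨j, rfl⟩, hj⟩, hz⟩ := hz
    refine hz ⟨j, fun hji => hj ?_, rfl⟩
    rw [Set.mem_singleton_iff, show j = i from hji]
  · obtain ⟨i, j, hij, hne⟩ : ∃ i j, x i = x j ∧ i ≠ j := by
      simpa [Function.Injective] using hinj
    exact ⟨i, isAlgebraic_algebraMap
      (⟨x i, Algebra.subset_adjoin ⟨j, fun h => hne (h ▸ rfl : j = i).symm, hij.symm⟩⟩ :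
        Algebra.adjoin K (x '' {i}ᶜ))⟩

/-- `dim B ≤ #keep` for an affine domain `B` algebraic over the subalgebra generated by the
elements `ξ v`, `v ∈ keep` (`dim = trdeg ≤ #` of an algebraically spanning set). [folklore] -/
theorem ringKrullDim_le_card_of_isAlgebraic_adjoin [Algebra.FiniteType K B] {ι : Type*}
    (ξ : ι → B) (keep : Finset ι)
    [Algebra.IsAlgebraic (Algebra.adjoin K (ξ '' ↑keep)) B] :
    ringKrullDim B ≤ keep.card := by
  classical
  have h1 : Algebra.trdeg K B ≤ Cardinal.mk (ξ '' (↑keep : Set ι)) :=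
    Algebra.IsAlgebraic.trdeg_le_cardinalMk K _
  have h2 : Cardinal.mk (ξ '' (↑keep : Set ι)) ≤ keep.card := by
    rw [← Finset.coe_image]
    calc Cardinal.mk ((↑(keep.image ξ) : Set B)) = ((keep.image ξ).card : Cardinal) :=
          Cardinal.mk_coe_finset
      _ ≤ keep.card := by exact_mod_cast Finset.card_image_le
  have h3 : Cardinal.toNat (Algebra.trdeg K B) ≤ keep.card := by
    have := Cardinal.toNat_le_toNat (h1.trans h2) (Cardinal.natCast_lt_aleph0)
    rwa [Cardinal.toNat_natCast] at this
  rw [ringKrullDim_eq_trdeg K B]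
  exact_mod_cast h3

end Algebraic

end Summit.ValiantsHypothesis.ValiantsHypothesis.Theorems.DetQPDetqpSuperquadratic
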